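import Literature.Analysis.FluidPDE.MikadoFlows
import HarnessLib

/-!
# Shifted Mikado pipes on `𝕋^d`: translates, tubes, and a separation criterion

Fifth file of the Mikado tool-kit (`TransverseProfile`, `TransversePeriodization`, `TransversePullback`,
`MikadoFlows`). The profiles `Mikado.psi x μ`, `Mikado.phi x μ` of `MikadoFlows` (Cheskidov–Luo 2022, §4.1)
are concentrated, for `μ` large, in the tube of width `∼ 1/μ` around the closed geodesic
`{y : L_x y = c₀}` of direction `k_x` (`L_x = (datum x).hom`, `c₀ = (1/2, …, 1/2)`); all these geodesics pass
near the same points, so the pipes of different directions INTERSECT. The Mikado flows of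
Daneri–Székelyhidi (ARMA 224 (2017), Lemma 2.3 — quoted as Lemma 5.1 by Buckmaster–De Lellis–
Székelyhidi–Vicol, CPAM 72 (2019)) need PAIRWISE DISJOINT pipes: "since there are only a finite number of
such lines, we may choose `p_k` and `r_k > 0` in such a way that `supp ψ_i ∩ supp ψ_j = ∅` for `i ≠ j`"
(DaSz17, proof of Lemma 2.3). This file supplies the dimension-free part of that sentence:

* translates `y ↦ f (y - s)` on `𝕋^d`: smoothness, `D`, `∂ₗ`, `Δ`, `∫` (`Mikado.isSmooth_comp_sub`, …);
* the shifted profiles `Mikado.psiS x μ s = ψ_x(· - s)`, `Mikado.phiS x μ s` with `Δ φ = ψ`, invariance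
  along `k_x` of `ψ`, `φ` and `∂ₗφ`, `∫ ψ = 0`, `∫ ψ² = 1`;
* the tube `Mikado.tubeOf T μ s = {y : L(y - s) = proj z, |z - c₀| ≤ 1/(4μ)}` of a transverse datum and
  the SUPPORT statements `ψ(y) ≠ 0 ⇒ y ∈ tube`, `∂ₗψ(y) ≠ 0 ⇒ y ∈ tube` (`Mikado.ConcNear`);
* the characters `Mikado.chi n : 𝕋^d →+ 𝕋¹`, `y ↦ ∑ nₗ yₗ` (`n ∈ ℤ^d`), the identity
  `χ_n = ∑ a_{l'} (L y)_{l'}` when `n = A a` lies in the `ℤ`-row span of the forms (`chi_eq_sum_hom`), and the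
  **separation criterion** `Mikado.tubeOf_disjoint`: two tubes whose phases `n·p + ∑a/2`, `n·p' + ∑a'/2`
  along a common normal `n` are `δ`-separated mod `1`, `δ > (|a|₁ + |a'|₁)/(4μ)`, are disjoint.

The certificates `n = A a` for the directions of the geometric lemma, the explicit shifts for `d = 3` and
the resulting pairwise disjointness are in `MikadoDisjointPipes`.
Everything is proved; no named facts.

## References

* S. Daneri, L. Székelyhidi Jr., *Non-uniqueness and h-principle for Hölder-continuous weak solutions of
  the Euler equations*, ARMA 224 (2017) = arXiv:1603.09714, Lemma 2.3 and its proof. [`DaneriSzekelyhidi2017`]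
* T. Buckmaster, C. De Lellis, L. Székelyhidi Jr., V. Vicol, CPAM 72 (2019) = arXiv:1701.08678, Lemma 5.1.
  [`BuckmasterEtAl2018`]
* A. Cheskidov, X. Luo, Invent. Math. 229 (2022) = arXiv:2009.06596, §4.1. [`CheskidovLuo2022`]
-/

noncomputable section

open Set Filter Topology Function MeasureTheory Metric Finset
open scoped ContDiff

namespace Literature.Analysis.FluidPDE

namespace Mikado

open FunctionSpaces FunctionSpaces.Torus NashGeometric Transverse

variable {d : Type*} [Fintype d] [DecidableEq d]
variable {F : Type*} [NormedAddCommGroup F] [NormedSpace ℝ F]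

/-! ## Translates of functions on the torus -/

section Translate

omit [Fintype d] [DecidableEq d] [NormedAddCommGroup F] [NormedSpace ℝ F] in
/-- Re-centred lifts of a translate: `liftAt (f(· - s)) y = liftAt f (y - s)`. [folklore] -/
theorem liftAt_comp_sub (f : UnitAddTorus d → F) (s y : UnitAddTorus d) :
    liftAt (fun y => f (y - s)) y = liftAt f (y - s) := by
  funext v
  simp only [liftAt_apply]
  rw [add_sub_right_comm]

omit [DecidableEq d] in
/-- Translates of `C^n` functions are `C^n`. [folklore] -/
theorem isContDiff_comp_sub {n : WithTop ℕ∞} {f : UnitAddTorus d → F} (hf : IsContDiff n f)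
    (s : UnitAddTorus d) : IsContDiff n (fun y => f (y - s)) := by
  obtain ⟨S, rfl⟩ := proj_surjective s
  have h : lift (fun y => f (y - proj S)) = lift f ∘ fun v => v - S := by
    funext v
    simp [sub_eq_add_neg]
  unfold IsContDiff
  rw [h]
  exact hf.comp (contDiff_id.sub contDiff_const)

omit [DecidableEq d] in
/-- Translates of smooth functions are smooth. [folklore] -/
theorem isSmooth_comp_sub {f : UnitAddTorus d → F} (hf : IsSmooth f) (s : UnitAddTorus d) :
    IsSmooth (fun y => f (y - s)) :=
  isContDiff_comp_sub hf s

omit [Fintype d] [DecidableEq d] in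
/-- `D(f(· - s))(y) = Df(y - s)`. [folklore] -/
theorem fderiv_comp_sub (f : UnitAddTorus d → F) (s y : UnitAddTorus d) :
    Torus.fderiv (fun y => f (y - s)) y = Torus.fderiv f (y - s) := by
  unfold Torus.fderiv
  rw [liftAt_comp_sub]

omit [Fintype d] [DecidableEq d] in
/-- `∂_v (f(· - s))(y) = ∂_v f (y - s)`. [folklore] -/
theorem lineDeriv_comp_sub (f : UnitAddTorus d → F) (s y : UnitAddTorus d) (v : EuclideanSpace ℝ d) :
    Torus.lineDeriv (fun y => f (y - s)) y v = Torus.lineDeriv f (y - s) v := by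
  unfold Torus.lineDeriv
  congr 1
  funext t
  dsimp only
  rw [add_sub_right_comm]

omit [Fintype d] in
/-- `∂ₗ (f(· - s)) = (∂ₗ f)(· - s)`. [folklore] -/
theorem partialDeriv_comp_sub (l : d) (f : UnitAddTorus d → F) (s : UnitAddTorus d) :
    partialDeriv l (fun y => f (y - s)) = fun y => partialDeriv l f (y - s) := by
  funext y
  exact lineDeriv_comp_sub f s y _

omit [DecidableEq d] in
/-- `Δ (f(· - s)) = (Δ f)(· - s)`. [folklore] -/
theorem laplacian_comp_sub (f : UnitAddTorus d → F) (s : UnitAddTorus d) :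
    laplacian (fun y => f (y - s)) = fun y => laplacian f (y - s) := by
  funext y
  unfold Torus.laplacian
  rw [liftAt_comp_sub]

omit [DecidableEq d] in
/-- `∫ f(y - s) dy = ∫ f` (invariance of the Haar measure). [folklore] -/
theorem integral_comp_sub (f : UnitAddTorus d → F) (s : UnitAddTorus d) :
    ∫ y, f (y - s) = ∫ y, f y :=
  integral_sub_right_eq_self f s

end Translate

/-! ## Partial derivatives of pull-backs are pull-backs -/

section Pull

variable {m : Type*} [Fintype m] [DecidableEq m]

/-- `∂ₗ (G ∘ L) = (∑_{l'} A l l' ∂_{l'} G) ∘ L`: partial derivatives of pull-backs are pull-backs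
(function form of `TransverseDatum.partialDeriv_pull`). [folklore] -/
theorem partialDeriv_pull_eq_pull (T : TransverseDatum d m) {G : UnitAddTorus m → F} (hG : IsContDiff 1 G)
    (l : d) : partialDeriv l (T.pull G) = T.pull fun w => ∑ l', (T.A l l' : ℝ) • partialDeriv l' G w := by
  funext y
  exact T.partialDeriv_pull hG l y

/-- The partial derivatives of a pulled-back smooth function are invariant along the direction:
`D(∂ₗ(G ∘ L))(y) k = 0`. [folklore] -/
theorem fderiv_partialDeriv_pull_dir (T : TransverseDatum d m) {G : UnitAddTorus m → F} (hG : IsSmooth G)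
    (l : d) (y : UnitAddTorus d) :
    Torus.fderiv (partialDeriv l (T.pull G)) y (WithLp.toLp 2 fun l => (T.k l : ℝ)) = 0 := by
  rw [partialDeriv_pull_eq_pull T (hG.isContDiff (by simp)) l]
  refine T.fderiv_pull_dir ?_ y
  have h : IsSmooth fun w => ∑ l', (T.A l l' : ℝ) • partialDeriv l' G w :=
    ContDiff.sum fun l' _ => ((hG.partialDeriv l').smul (T.A l l' : ℝ))
  exact h.isContDiff (by simp)

end Pull

/-! ## Concentration near the cube centre and tubes -/

section Tube

variable {m : Type*} [Fintype m] [DecidableEq m]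

/-- A function on `𝕋^m` is concentrated at scale `μ`: it vanishes at every point whose cube
representative is farther than `1/(4μ)` from the centre `c₀`. [folklore] -/
def ConcNear (μ : ℝ) (G : UnitAddTorus m → F) : Prop :=
  ∀ w, G w ≠ 0 → dist (repr w) (centre m) ≤ 1 / (4 * μ)

/-- Concentrated periodic profiles are concentrated at scale `μ` (`μ ≥ 1`). [folklore] -/
theorem concNear_conc {f₀ : EuclideanSpace ℝ m → ℝ} (hf : IsProfile f₀) {μ : ℝ} (hμ : 1 ≤ μ) (κ₀ a : ℝ) :
    ConcNear μ (conc κ₀ a μ f₀) := by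
  intro w hw
  rw [conc_apply hf hμ] at hw
  have h1 : f₀ (scaleAt m μ (repr w)) ≠ 0 := by
    intro h
    apply hw
    simp [rescale_apply, h]
  have h2 : scaleAt m μ (repr w) ∈ closedBall (centre m) (1 / 4) :=
    hf.tsupport_subset (subset_tsupport _ (mem_support.2 h1))
  rw [mem_closedBall, dist_scaleAt (by linarith)] at h2
  rw [le_div_iff₀ (by linarith)]
  nlinarith [h2, dist_nonneg (x := repr w) (y := centre m)]

/-- Partial derivatives of concentrated periodic profiles are concentrated. [folklore] -/
theorem concNear_partialDeriv_conc {f₀ : EuclideanSpace ℝ m → ℝ} (hf : IsProfile f₀) {μ : ℝ} (hμ : 1 ≤ μ)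
    (κ₀ a : ℝ) (l : m) : ConcNear μ (partialDeriv l (conc κ₀ a μ f₀)) := by
  rw [partialDeriv_conc hf hμ]
  exact concNear_conc (hf.pd l) hμ κ₀ (a + 1)

omit [DecidableEq m] in
/-- Scalar multiples of concentrated functions are concentrated. [folklore] -/
theorem ConcNear.smul {μ : ℝ} {G : UnitAddTorus m → F} (hG : ConcNear μ G) (c : ℝ) :
    ConcNear μ fun w => c • G w := by
  intro w hw
  exact hG w fun h => hw (by simp [h])

omit [DecidableEq m] [NormedSpace ℝ F] in
/-- Finite sums of concentrated functions are concentrated. [folklore] -/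
theorem concNear_sum {μ : ℝ} {ι : Type*} (s : Finset ι) {G : ι → UnitAddTorus m → F}
    (hG : ∀ i ∈ s, ConcNear μ (G i)) : ConcNear μ fun w => ∑ i ∈ s, G i w := by
  intro w hw
  obtain ⟨i, hi, hne⟩ := Finset.exists_ne_zero_of_sum_ne_zero hw
  exact hG i hi w hne

/-- **The tube** of a transverse datum `T` at scale `μ` with shift `s`: the points `y ∈ 𝕋^d` with
`L(y - s) = proj z` for some `z` in the transverse ball `|z - c₀| ≤ 1/(4μ)` — the `1/(4μ)`-neighbourhood,
in the transverse variables, of the shifted closed geodesic `{L(y - s) = proj c₀}` of direction `k`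
(DaSz17: the `𝕋³`-periodic extension of the line `{p_k + tk}`). [cite: DaneriSzekelyhidi2017, Lemma 2.3 (proof)] -/
def tubeOf (T : TransverseDatum d m) (μ : ℝ) (s : UnitAddTorus d) : Set (UnitAddTorus d) :=
  {y | ∃ z : EuclideanSpace ℝ m, dist z (centre m) ≤ 1 / (4 * μ) ∧ proj z = T.hom (y - s)}

omit [DecidableEq d] [NormedSpace ℝ F] in
/-- **Support**: a pulled-back concentrated function, shifted by `s`, vanishes off the tube. [folklore] -/
theorem mem_tubeOf_of_ne_zero (T : TransverseDatum d m) {μ : ℝ} {G : UnitAddTorus m → F} (hG : ConcNear μ G)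
    {s y : UnitAddTorus d} (h : T.pull G (y - s) ≠ 0) : y ∈ tubeOf T μ s :=
  ⟨repr (T.hom (y - s)), hG _ h, proj_repr _⟩

end Tube

/-! ## Characters and the separation criterion -/

section Character

variable {m : Type*} [Fintype m] [DecidableEq m]

omit [DecidableEq d] in
/-- The character `χ_n : 𝕋^d →+ 𝕋¹`, `y ↦ ∑ₗ nₗ yₗ`, of a lattice vector `n ∈ ℤ^d`. [folklore] -/
def chi (n : d → ℤ) : UnitAddTorus d →+ UnitAddCircle where
  toFun y := ∑ l, n l • y l
  map_zero' := by simp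
  map_add' y y' := by simp [Finset.sum_add_distrib]

omit [DecidableEq d] in
/-- Unfolding `χ_n`. [folklore] -/
theorem chi_apply (n : d → ℤ) (y : UnitAddTorus d) : chi n y = ∑ l, n l • y l := rfl

omit [DecidableEq d] in
/-- `χ_n (proj Y) = n·Y mod 1`. [folklore] -/
theorem chi_proj (n : d → ℤ) (Y : EuclideanSpace ℝ d) :
    chi n (proj Y) = (((∑ l, (n l : ℝ) * Y l : ℝ)) : UnitAddCircle) := by
  rw [chi_apply, TransverseDatum.coe_sum_unitAddCircle]
  refine Finset.sum_congr rfl fun l _ => ?_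
  rw [proj_apply, ← zsmul_eq_mul, AddCircle.coe_zsmul]

omit [DecidableEq d] in
/-- If `n = A a` is an integer combination of the transverse forms, `χ_n` factors through `L`:
`χ_n(y) = ∑_{l'} a_{l'} (L y)_{l'}`. [folklore] -/
theorem chi_eq_sum_hom (T : TransverseDatum d m) {n : d → ℤ} {a : m → ℤ}
    (hna : ∀ l, n l = ∑ l', T.A l l' * a l') (y : UnitAddTorus d) :
    chi n y = ∑ l', a l' • T.hom y l' := by
  simp only [chi_apply, TransverseDatum.hom_apply, hna, Finset.sum_smul, Finset.smul_sum, smul_smul]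
  rw [Finset.sum_comm]
  exact Finset.sum_congr rfl fun l' _ => Finset.sum_congr rfl fun l _ => by rw [mul_comm]

omit [DecidableEq d] in
/-- **Phase of a tube along a character**: on the tube of `T` with shift `proj S`, for `n = A a`,
`χ_n(y) = n·S + ∑ a_{l'} z_{l'} mod 1` with `|z - c₀| ≤ 1/(4μ)`. [folklore] -/
theorem chi_of_mem_tubeOf (T : TransverseDatum d m) {n : d → ℤ} {a : m → ℤ}
    (hna : ∀ l, n l = ∑ l', T.A l l' * a l') {μ : ℝ} (S : EuclideanSpace ℝ d) {y : UnitAddTorus d}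
    (hy : y ∈ tubeOf T μ (proj S)) :
    ∃ z : EuclideanSpace ℝ m, dist z (centre m) ≤ 1 / (4 * μ) ∧
      chi n y = (((∑ l, (n l : ℝ) * S l) + ∑ l', (a l' : ℝ) * z l' : ℝ) : UnitAddCircle) := by
  obtain ⟨z, hz, hzy⟩ := hy
  refine ⟨z, hz, ?_⟩
  have h1 : chi n y = chi n (y - proj S) + chi n (proj S) := by
    rw [← map_add, sub_add_cancel]
  have h2 : chi n (y - proj S) = ((∑ l', (a l' : ℝ) * z l' : ℝ) : UnitAddCircle) := by
    rw [chi_eq_sum_hom T hna, ← hzy, TransverseDatum.coe_sum_unitAddCircle]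
    refine Finset.sum_congr rfl fun l' _ => ?_
    rw [proj_apply, ← zsmul_eq_mul, AddCircle.coe_zsmul]
  rw [h1, h2, chi_proj, ← AddCircle.coe_add, add_comm]

omit [Fintype m] [DecidableEq m] in
/-- `|∑ a_{l'} (z_{l'} - 1/2)| ≤ |a|₁ · dist(z, c₀)`. [folklore] -/
theorem abs_sum_mul_sub_half_le [Fintype m] (a : m → ℤ) (z : EuclideanSpace ℝ m) :
    |∑ l', (a l' : ℝ) * (z l' - 1 / 2)| ≤ (∑ l', |(a l' : ℝ)|) * dist z (centre m) := by
  refine (Finset.abs_sum_le_sum_abs _ _).trans ?_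
  rw [Finset.sum_mul]
  refine Finset.sum_le_sum fun l' _ => ?_
  rw [abs_mul]
  refine mul_le_mul_of_nonneg_left ?_ (abs_nonneg _)
  have h := PiLp.norm_apply_le (z - centre m) l'
  simp only [PiLp.sub_apply, centre, Real.norm_eq_abs] at h
  rwa [dist_eq_norm]

omit [DecidableEq d] in
/-- **Separation criterion** (the quantitative form of "we may choose `p_k` and `r_k > 0` in such a way
that `supp ψ_i ∩ supp ψ_j = ∅`", DaSz17): let `n ∈ ℤ^d` be a common integer combination `n = A a = A' a'` of
the transverse forms of two data (a common normal of the two directions). If the phases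
`n·S + ∑a/2` and `n·S' + ∑a'/2` are `δ`-separated modulo `ℤ` and `(|a|₁ + |a'|₁)/(4μ) < δ`, the two tubes
at scale `μ` with shifts `proj S`, `proj S'` are disjoint: on the first `χ_n ∈ n·S + ∑a/2 + [-|a|₁/(4μ), |a|₁/(4μ)]`,
on the second `χ_n ∈ n·S' + ∑a'/2 + [-|a'|₁/(4μ), |a'|₁/(4μ)]` (mod `1`).
[cite: DaneriSzekelyhidi2017, Lemma 2.3 (proof)] -/
theorem tubeOf_disjoint {m' : Type*} [Fintype m'] [DecidableEq m']
    (T : TransverseDatum d m) (T' : TransverseDatum d m') {n : d → ℤ} {a : m → ℤ} {a' : m' → ℤ}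
    (hna : ∀ l, n l = ∑ l', T.A l l' * a l') (hna' : ∀ l, n l = ∑ l', T'.A l l' * a' l')
    (S S' : EuclideanSpace ℝ d) {μ δ : ℝ}
    (hsep : ∀ k : ℤ, δ ≤ |(∑ l, (n l : ℝ) * (S l - S' l)) +
      ((∑ l', (a l' : ℝ)) - ∑ l', (a' l' : ℝ)) / 2 - k|)
    (hsmall : ((∑ l', |(a l' : ℝ)|) + ∑ l', |(a' l' : ℝ)|) / (4 * μ) < δ) {y : UnitAddTorus d}
    (hy : y ∈ tubeOf T μ (proj S)) (hy' : y ∈ tubeOf T' μ (proj S')) : False := by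
  obtain ⟨z, hz, hχ⟩ := chi_of_mem_tubeOf T hna S hy
  obtain ⟨z', hz', hχ'⟩ := chi_of_mem_tubeOf T' hna' S' hy'
  set A : ℝ := (∑ l, (n l : ℝ) * S l) + ∑ l', (a l' : ℝ) * z l' with hA
  set A' : ℝ := (∑ l, (n l : ℝ) * S' l) + ∑ l', (a' l' : ℝ) * z' l' with hA'
  have h0 : ((A - A' : ℝ) : UnitAddCircle) = 0 := by
    rw [AddCircle.coe_sub, ← hχ, ← hχ', sub_self]
  obtain ⟨k, hk⟩ := (AddCircle.coe_eq_zero_iff (1 : ℝ)).1 h0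
  rw [zsmul_one] at hk
  -- the separated quantity equals `e' - e` with the two small errors `e`, `e'`
  set e : ℝ := ∑ l', (a l' : ℝ) * (z l' - 1 / 2) with he
  set e' : ℝ := ∑ l', (a' l' : ℝ) * (z' l' - 1 / 2) with he'
  have hsumz : ∑ l', (a l' : ℝ) * z l' = (∑ l', (a l' : ℝ)) / 2 + e := by
    rw [he, Finset.sum_div, ← Finset.sum_add_distrib]
    exact Finset.sum_congr rfl fun l' _ => by ring
  have hsumz' : ∑ l', (a' l' : ℝ) * z' l' = (∑ l', (a' l' : ℝ)) / 2 + e' := by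
    rw [he', Finset.sum_div, ← Finset.sum_add_distrib]
    exact Finset.sum_congr rfl fun l' _ => by ring
  have hnS : ∑ l, (n l : ℝ) * (S l - S' l) = (∑ l, (n l : ℝ) * S l) - ∑ l, (n l : ℝ) * S' l := by
    rw [← Finset.sum_sub_distrib]
    exact Finset.sum_congr rfl fun l _ => by ring
  have hQ : (∑ l, (n l : ℝ) * (S l - S' l)) + ((∑ l', (a l' : ℝ)) - ∑ l', (a' l' : ℝ)) / 2 - k = e' - e := by
    rw [hnS, hk, hA, hA', hsumz, hsumz']
    ring
  have hbe : |e| ≤ (∑ l', |(a l' : ℝ)|) * (1 / (4 * μ)) :=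
    (abs_sum_mul_sub_half_le a z).trans (mul_le_mul_of_nonneg_left hz (Finset.sum_nonneg fun _ _ => abs_nonneg _))
  have hbe' : |e'| ≤ (∑ l', |(a' l' : ℝ)|) * (1 / (4 * μ)) :=
    (abs_sum_mul_sub_half_le a' z').trans (mul_le_mul_of_nonneg_left hz' (Finset.sum_nonneg fun _ _ => abs_nonneg _))
  have h := hsep k
  rw [hQ] at h
  have h3 : |e' - e| ≤ |e'| + |e| := abs_sub _ _
  have h4 : (∑ l', |(a l' : ℝ)|) * (1 / (4 * μ)) + (∑ l', |(a' l' : ℝ)|) * (1 / (4 * μ)) =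
      ((∑ l', |(a l' : ℝ)|) + ∑ l', |(a' l' : ℝ)|) / (4 * μ) := by ring
  linarith

end Character

/-! ## Shifted Mikado profiles -/

section Shifted

/-- **The shifted pipe profile** `ψ_x(· - s)` (DaSz17: the profile around the line through `p_k`).
[cite: DaneriSzekelyhidi2017, Lemma 2.3 (proof)] -/
def psiS (x : Index d) (μ : ℝ) (s : UnitAddTorus d) (y : UnitAddTorus d) : ℝ := psi x μ (y - s)

/-- The shifted potential `φ_x(· - s)`, `Δ φ = ψ`. [folklore] -/
def phiS (x : Index d) (μ : ℝ) (s : UnitAddTorus d) (y : UnitAddTorus d) : ℝ := phi x μ (y - s)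

/-- The tube of direction `k_x` at scale `μ` with shift `s`. [cite: DaneriSzekelyhidi2017, Lemma 2.3 (proof)] -/
def tube (x : Index d) (μ : ℝ) (s : UnitAddTorus d) : Set (UnitAddTorus d) := tubeOf (datum x) μ s

variable {x : Index d} {μ : ℝ} {s : UnitAddTorus d}

/-- `ψ_x(· - s)` is smooth (`μ ≥ 1`). [folklore] -/
theorem isSmooth_psiS (x : Index d) (hμ : 1 ≤ μ) (s : UnitAddTorus d) : IsSmooth (psiS x μ s) :=
  isSmooth_comp_sub (isSmooth_psi x hμ) s

/-- `φ_x(· - s)` is smooth (`μ ≥ 1`). [folklore] -/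
theorem isSmooth_phiS (x : Index d) (hμ : 1 ≤ μ) (s : UnitAddTorus d) : IsSmooth (phiS x μ s) :=
  isSmooth_comp_sub (isSmooth_phi x hμ) s

/-- **`Δ φ_x(· - s) = ψ_x(· - s)`**. [folklore] -/
theorem laplacian_phiS (x : Index d) (hμ : 1 ≤ μ) (s : UnitAddTorus d) :
    laplacian (phiS x μ s) = psiS x μ s := by
  unfold phiS psiS
  rw [laplacian_comp_sub, laplacian_phi x hμ]

/-- **Invariance along the pipe**: `D ψ_x(· - s)(y) k_x = 0`. [folklore] -/
theorem fderiv_psiS_dirVec (x : Index d) (hμ : 1 ≤ μ) (s y : UnitAddTorus d) :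
    Torus.fderiv (psiS x μ s) y (dirVec x) = 0 := by
  unfold psiS
  rw [fderiv_comp_sub]
  exact fderiv_psi_dirVec x hμ _

/-- The first derivatives of the potential are invariant along the pipe: `D(∂ₗ φ_x(· - s))(y) k_x = 0`. [folklore] -/
theorem fderiv_partialDeriv_phiS_dirVec (x : Index d) (hμ : 1 ≤ μ) (s : UnitAddTorus d) (l : d)
    (y : UnitAddTorus d) : Torus.fderiv (partialDeriv l (phiS x μ s)) y (dirVec x) = 0 := by
  unfold phiS
  rw [partialDeriv_comp_sub, fderiv_comp_sub]
  have h := fderiv_partialDeriv_pull_dir (datum x) (isSmooth_phiT (datum x).c hμ) l (y - s)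
  rwa [datum_k] at h

/-- `∫ ψ_x(· - s) = 0`. [folklore] -/
theorem integral_psiS (x : Index d) (hμ : 1 ≤ μ) (s : UnitAddTorus d) : ∫ y, psiS x μ s y = 0 := by
  unfold psiS
  rw [integral_comp_sub (psi x μ) s]
  exact integral_psi x hμ

/-- **Unit energy**: `∫ ψ_x(· - s)² = 1` (`d ≥ 2`). [folklore] -/
theorem integral_psiS_sq (hd : 2 ≤ Fintype.card d) (x : Index d) (hμ : 1 ≤ μ) (s : UnitAddTorus d) :
    ∫ y, psiS x μ s y ^ 2 = 1 := by
  unfold psiS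
  rw [integral_comp_sub (fun y => psi x μ y ^ 2) s]
  exact integral_psi_sq hd x hμ

/-- **Support of the pipe profile**: `ψ_x(y - s) ≠ 0 ⇒ y ∈ tube`. [folklore] -/
theorem mem_tube_of_psiS_ne_zero (hμ : 1 ≤ μ) {y : UnitAddTorus d} (h : psiS x μ s y ≠ 0) :
    y ∈ tube x μ s :=
  mem_tubeOf_of_ne_zero (datum x) (concNear_conc (isProfile_psi0 _) hμ _ _) h

/-- **Support of the derivatives of the pipe profile**: `∂ₗ ψ_x(· - s)(y) ≠ 0 ⇒ y ∈ tube`. [folklore] -/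
theorem mem_tube_of_partialDeriv_psiS_ne_zero (hμ : 1 ≤ μ) (l : d) {y : UnitAddTorus d}
    (h : partialDeriv l (psiS x μ s) y ≠ 0) : y ∈ tube x μ s := by
  unfold psiS at h
  rw [partialDeriv_comp_sub, psi,
    partialDeriv_pull_eq_pull (datum x) ((isSmooth_psiT (datum x).c hμ).isContDiff (by simp)) l] at h
  refine mem_tubeOf_of_ne_zero (datum x) ?_ h
  exact concNear_sum _ fun l' _ => (concNear_partialDeriv_conc (isProfile_psi0 _) hμ _ _ l').smul _

end Shifted

end Mikado

end Literature.Analysis.FluidPDE
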